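import Literature.AlgebraicGeometry.Resolution.DiffIdealLocalizationGeneral
import Literature.AlgebraicGeometry.Resolution.DiffIdealSheaf
import Literature.AlgebraicGeometry.Resolution.MarkedIdealsHomogenized
import HarnessLib

/-!
# Stalks of the ideal sheaves `Diff^{≤ n}(𝓘)`: `Diff^{≤ n}(𝓘)_x = Diff^{≤ n}(𝓘_x)`

Topic `Literature/AlgebraicGeometry/Resolution`. Stalk-level companion of `DiffIdealSheaf.lean` (sections:
`Diff^{≤ n}(𝓘)(U) = Diff^{≤ n}(𝓘(U))`), in the style of `DerivativeIdealSheaf.stalkIdeal_derivIdealSheaf`: on a scheme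
`X` with a `K`-structure whose affine pieces are of finite type over the FIELD `K` (`HasFiniteTypeSections φ`), for every
quasi-coherent ideal sheaf `𝓘` and every point `x`,

* `stalkIdeal_diffIdealSheaf` — `(Diff^{≤ n}(𝓘))_x = Diff^{≤ n}(𝓘_x)`, the right-hand side computed in the `K`-algebra
  `𝒪_{X,x}` (`stalkAlgebra φ x`) with the tree's `diffIdeal` (commutator definition of differential operators);
* `stalkIdeal_ofIdeals_biSup_diffIdeals` — the same for the `ofIdeals` of a doubly indexed supremum of
  `Diff`-families `U ↦ ⨆ i, ⨆ (_ : p i), Diff^{≤ k i}(J i (U))` (the shape of Eq. (36) of the Hironaka typing,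
  `℘̃(E,−a)`): its stalk at `x` is `⨆ i, ⨆ (_ : p i), Diff^{≤ k i}((J i)_x)`.

Both rest on `map_diffIdeal_eq_of_isLocalization` (`DiffIdealLocalizationGeneral.lean`: `Diff^{≤ n}` commutes with the
localisation `Γ(X,U) → 𝒪_{X,x}`, EGA IV₄ Prop. 16.8.6) and on `stalkIdeal_eq_map_germ` (`MarkedIdeals.lean`).
Consumers (index only): the campaign `res-hironaka` compares the STALK carriers `pTildeNegAt`/`pNegaAt` (defined
directly in `𝒪_{Z,ξ}`) with the stalks of the SHEAF carriers `pTildeNegSheaf`/`pNegaSheaf` (row 008 of the Hironaka 2017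
typing; «agreement … NOT proved here» in `R008bPNega`). [EGAIV4]
-/

namespace Literature.AlgebraicGeometry.Resolution

open CategoryTheory _root_.AlgebraicGeometry TopologicalSpace Opposite

universe u v

section Stalk

variable {K : Type v} [Field K] {X : Scheme.{u}} {φ : K →+* Γ(X, ⊤)}

/-- **Stalks of `Diff^{≤ n}(𝓘)`**: `(Diff^{≤ n}(𝓘))_x = Diff^{≤ n}(𝓘_x)` in the `K`-algebra `𝒪_{X,x}` (finite-type sections
over the field `K`; `Diff^{≤ n}` commutes with the localisation `Γ(X, U) → 𝒪_{X,x}`).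
[cite: EGAIV4, Prop. 16.8.6 p.41 (quasi-coherence of Diff^n; stalks of a quasi-coherent sheaf)] -/
theorem stalkIdeal_diffIdealSheaf (hX : HasFiniteTypeSections φ) (n : ℕ) (I : X.IdealSheafData) (x : X) :
    stalkIdeal (diffIdealSheaf φ n I) x = (letI := stalkAlgebra φ x; diffIdeal K n (stalkIdeal I x)) := by
  obtain ⟨U, hU, hxU, -⟩ :=
    exists_isAffineOpen_mem_and_subset (X := X) (x := x) (U := ⊤) (Opens.mem_top x)
  letI := sectionsAlgebra φ U
  letI := stalkAlgebra φ x
  letI algx : Algebra Γ(X, U) (X.presheaf.stalk x) := (X.presheaf.germ U x hxU).hom.toAlgebra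
  haveI : IsScalarTower K Γ(X, U) (X.presheaf.stalk x) :=
    IsScalarTower.of_algebraMap_eq fun c =>
      (RingHom.congr_fun (germ_comp_sectionsHom φ U x hxU) c).symm
  haveI : IsLocalization.AtPrime (X.presheaf.stalk x) (hU.primeIdealOf ⟨x, hxU⟩).asIdeal :=
    hU.isLocalization_stalk ⟨x, hxU⟩
  haveI : Algebra.FiniteType K Γ(X, U) := hX ⟨U, hU⟩
  rw [stalkIdeal_eq_map_germ _ ⟨U, hU⟩ hxU, stalkIdeal_eq_map_germ I ⟨U, hU⟩ hxU, diffIdealSheaf_ideal hX]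
  exact map_diffIdeal_eq_of_isLocalization K (X.presheaf.stalk x)
    (hU.primeIdealOf ⟨x, hxU⟩).asIdeal.primeCompl n (I.ideal ⟨U, hU⟩)

/-- **Stalks of `ofIdeals` of a doubly indexed supremum of `Diff`-families** (the shape of Eq. (36) of the Hironaka
typing): `(ofIdeals (U ↦ ⨆ i, ⨆ (_ : p i), Diff^{≤ k i}(J i (U))))_x = ⨆ i, ⨆ (_ : p i), Diff^{≤ k i}((J i)_x)`.
[cite: EGAIV4, Prop. 16.8.6 p.41 (quasi-coherence of Diff^n; stalks of sums of quasi-coherent ideals)] -/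
theorem stalkIdeal_ofIdeals_biSup_diffIdeals (hX : HasFiniteTypeSections φ) {ι : Type*} (p : ι → Prop)
    (k : ι → ℕ) (J : ι → X.IdealSheafData) (x : X) :
    stalkIdeal (Scheme.IdealSheafData.ofIdeals fun V => ⨆ i, ⨆ (_ : p i), diffIdeals φ (k i) (J i) V) x =
      ⨆ i, ⨆ (_ : p i), (letI := stalkAlgebra φ x; diffIdeal K (k i) (stalkIdeal (J i) x)) := by
  -- the family is the section family of the ideal sheaf `⨆ (i : Subtype p), Diff^{≤ k i}(J i)`
  have hfam : (fun V => ⨆ i, ⨆ (_ : p i), diffIdeals φ (k i) (J i) V) =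
      (⨆ y : Subtype p, diffIdealSheafData hX (k y.1) (J y.1)).ideal := by
    funext V
    rw [iSup_subtype', Scheme.IdealSheafData.ideal_iSup, iSup_apply]
    rfl
  rw [hfam, Scheme.IdealSheafData.ofIdeals_ideal, stalkIdeal_iSup, iSup_subtype']
  refine iSup_congr fun y => ?_
  rw [← diffIdealSheaf_eq hX, stalkIdeal_diffIdealSheaf hX]

end Stalk

end Literature.AlgebraicGeometry.Resolution
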